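import Mathlib
import HarnessLib
import HarnessLib.Audit
import Summits.CriticalPhenomena.Statement

/-!
Route: PercDivergentSlabLadder

DORMANT since 2026-08-29T07:03:22Z (reconciler: no traction for 5 d (last activity statement-closed at 2026-08-24T04:47:13Z); parked, not closed — `ledger route dormant route-CriticalPhenomena-PercDivergentSlabLadder --off` to reactivat) — unstaffed, not closed; items shared with open routes are served there. `ledger route dormant <id> --off` reactivates.

# Route PercDivergentSlabLadder — no percolation at p_c(Z^3) in two-sided divergent slabs |x_0| <=
f(rho) — a rung ladder from DST's slab to the double-cone rung, closed by a same-p line-cone removal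

It suffices to show X = ConeRung ∧ LineConeRemoval (card thickening-critical-slab-ladder). Notation:
ρ(x) = max(|x_1|,|x_2|), C_k = {|x_0| ≤ k} the centred slab of ℤ³ (the tree's `slab_blocks` slab),
V_f = {x ∈ ℤ³ : |x_0| ≤ f(ρ(x))} the two-sided DIVERGENT SLAB of profile f, and Rung(f) := "bond
percolation on the induced graph ℤ³[V_f] has θ = 0 at every vertex at p = p_c(ℤ³)". Rung is antitone
in f; f ≡ k is DST's theorem transported to p_c(ℤ³) (PROVED in tree), and the rungs climb through
sublinear f, small cones f = r/M, all cones f = m·r (ConeRung: no percolation at p_c(ℤ³) outside ANY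
thin double cone {ρ < |x_0|/m} about a lattice line), to the conjunct, which lies strictly above
every rung (constant-p_c exhaustion does not transmit θ = 0). The bridge is LineConeRemoval: a
percolating critical ℤ³ still percolates after deleting SOME thin double cone about a line. Below
ConeRung the route files three ENGINES, each a uniform-in-thickness statement about slabs at the
BULK critical point with its rung as proved-now glue: OneScaleSlabs (= crux U of card
no-creeping-tortuosity-price; ⟹ all sublinear rungs), FlatAnnulusCrossing (RSW for flat washers of
one aspect ratio; ⟹ small-cone rungs), SlabCrossoverPolynomial (polynomial crossover length; ⟹
polynomial rungs and strict subcriticality of every slab); plus the FREE RUNG (∃ unbounded f with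
Rung(f)), provable today from DST-in-tree alone.
Lean: `(∀ (m : ℕ) (x : ↥{z : Literature.Probability.LatticeModels.Site 3 | |z 0| ≤ (m : ℤ) * max |z
1| |z 2|}), Literature.Probability.Percolation.theta ((Literature.Probability.LatticeModels.zdGraph
3).induce {z : Literature.Probability.LatticeModels.Site 3 | |z 0| ≤ (m : ℤ) * max |z 1| |z 2|}) x
(Literature.Probability.Percolation.criticalProbI 3) = 0) ∧ (0 <
Literature.Probability.Percolation.theta (Literature.Probability.LatticeModels.zdGraph 3) 0
(Literature.Probability.Percolation.criticalProbI 3) → ∃ (m : ℕ) (x : ↥{z :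
Literature.Probability.LatticeModels.Site 3 | |z 0| ≤ (m : ℤ) * max |z 1| |z 2|}), 0 <
Literature.Probability.Percolation.theta ((Literature.Probability.LatticeModels.zdGraph 3).induce {z
: Literature.Probability.LatticeModels.Site 3 | |z 0| ≤ (m : ℤ) * max |z 1| |z 2|}) x
(Literature.Probability.Percolation.criticalProbI 3))`

## Assembly
Pure logic plus θ ≥ 0 (sorry-free in Sketch.lean, theorem assembly_provable): if θ_{ℤ³}(p_c) ≠ 0
then θ_{ℤ³}(p_c) > 0 (measureReal_nonneg), LineConeRemoval yields m and a vertex x of V_m with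
θ_{V_m}(x, p_c) > 0, contradicting ConeRung m x. The engines enter one layer down:
FlatAnnulusCrossing (all aspects, two-layer plan) → ConeRung; OneScaleSlabs /
SlabCrossoverPolynomial / FlatAnnulusCrossing → the sublinear, polynomial and small-cone rungs
through the filed glue; FreeRung unconditionally.

Rationale: WHY THIS LINE. Duminil-Copin–Sidoravicius–Tassion (arXiv:1401.7130, Thm 1; PROVED in tree as
DuminilCopinSidoraviciusTassion2016_holds, whence theta_slab_criticalProbI_eq_zero: θ_{S_k}(p_c(ℤ³))
= 0 for every k) and the conjunct are the two endpoints f ≡ const and f ≡ ∞ of ONE monotone family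
of statements Rung(f) at ONE parameter p_c(ℤ³), with no limit taken; the planar device of a region
whose width grows with the distance (Grimmett 1983 / Grimmett1999 Thm (11.55) log-wedges,
ChayesChayes 1986b doi:10.1088/0305-4470/19/15/026, Yu Zhang 1992 doi:10.1088/0305-4470/25/24/015
power-law failure on G(x^a); in ℤ³ only supercritically: Lyons 1983, Häggström–Mossel 1998,
Angel–Benjamini–Berger–Peres arXiv:math/0206130 on W_h = {x ≥ 0, |z| ≤ h(x)}) is transplanted to the
bulk critical point of ℤ³, where the tree now holds every input of the lower rungs (DST,
Grimmett–Marstrand slab_blocks, BGN, quasi-transitive sharpness). The score of a technique is the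
fastest f it certifies, and each engine is exactly a 'uniform modulus in the thickness' that the
barrier SlabLimitUniformControl (DST Prop. 3) says any slab-to-ℤ³ passage must supply — consumed
here at finite thickness, rung by rung, never in a limit. Imported areas: dimensional-crossover
scaling (statistical physics of films: ξ(C_k; p_c(∞)) ≍ k, crossover exponent 1/ν₃) as the source of
the engine statements, quasi-planar RSW/gluing technology (NTW arXiv:1512.09107, Basu–Sapozhnikov
arXiv:1512.05178) and strict monotonicity under coverings (MartineauSevero2019) as tools; no
spectral or probabilistic-model reformulation applies. Versus prior routes:
PercHalfSpace/PercOpenSupercrit ask same-p transfer INTO slabs (the conjunct in disguise);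
PercAnnulusCrossing asks bulk RSW (X_B); this line asks RSW/crossover only in FLAT geometry, where
the slab is genuinely subcritical, and isolates the same-p content in one removal statement about a
zero-density cone.

RANKED CRUXES. #2 OneScaleSlabs (crux) — ONE-SCALE SLABS (= crux U of card
no-creeping-tortuosity-price; this decl is meant to be shared): there is ρ'(K) → 0 such that for
every half-width k ≥ 1, every K and every vertex x, the probability at p_c(ℤ³) that x is joined
INSIDE the slab C_k = {|z_0| ≤ k} to a vertex at lateral (ρ-)distance ≥ K·k is at most ρ'(K) — slabs
at the bulk critical point are subcritical at exactly one scale, their thickness, uniformly in the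
thickness. For x on a face it is free from BGN (in tree); for fixed k it is free from DST (in tree);
the content is uniformity over interior x and k. Glue SublinearRungOfOneScale turns it into Rung(f)
for every f = o(r). [difficulty: L] (why it might fail: Uniformity in k is the whole content (NTW
slab-RSW constants c(k)→0, DST/BGN give nothing uniform for interior points); false iff slabs at
bulk p_c carry lateral connections ≫ thickness along a sequence k_j — an anomalous 3D→2D crossover,
conceivable only in a jump world.) [arXiv:1512.09107, arXiv:1401.7130, BarskyGrimmettNewman1991,
AizenmanBurchard1999, arXiv:1512.05178, DuminilCopinSidoraviciusTassion2016]
#3 FlatAnnulusCrossing (crux) — RSW FOR FLAT WASHERS AT ONE ASPECT RATIO, uniformly in thickness: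
there are M and c > 0 such that for all k ≥ 1 and R ≥ M·k, at p_c(ℤ³) the flat washer {|z_0| ≤ k, R
≤ ρ ≤ 2R} is crossed radially inside itself (open path from ρ = R to ρ = 2R) with probability ≤ 1 −
c. The scaling picture says far more (probability ≲ M e^{−cM} as k → ∞); only 'bounded away from 1
for ONE flat aspect' is asked. Glue SmallConeRungOfFlatAnnulus turns it into Rung(f) for every f
with f(r) ≤ r/(2M) eventually — the first CONE rungs. Fixed-k shadow: sup_R < 1 needs strict
subcriticality of C_k at p_c(ℤ³) (SlabStrictSubcritical) plus sharpness, or NTW's slab RSW.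
[difficulty: L] (why it might fail: An RSW upper bound uniform in thickness with no planar
crossing/gluing input available (transverse crossings need not meet); even the fixed-k case rests on
facts not in tree (Martineau–Severo strictness or NTW RSW); false iff washers of every fixed flat
aspect get crossed w.p.→1 along k_j→∞.) [arXiv:1512.09107, arXiv:1512.05178, MartineauSevero2019,
Grimmett1999, Literature.Barriers.CriticalPhenomena.TransverseCrossingsNeedNotMeet]
#4 SlabCrossoverPolynomial (crux) — POLYNOMIAL CROSSOVER (card Crux 1): there are A, C > 0 such that
for every k ≥ 1, n and x, P_{p_c(ℤ³)}(x is joined inside C_k to lateral distance ≥ n) ≤ C k^C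
exp(−n/(C k^A)) — the slab of half-width k is exponentially subcritical at the bulk critical point
with correlation length R(k) ≤ C k^A (truth: R(k) ≍ k). Implies strict subcriticality p_c(ℤ³) <
p_c(C_k) for every k with a rate, and (glue PolyRungOfCrossover) Rung(f) for f(r) = ⌈r^a⌉, any a <
1/A. Compatible with a jump (which forces only R(k) ≥ ck), hence a genuine intermediate theorem.
[difficulty: XL] (why it might fail: No tool bounds a SUBcritical correlation length at a parameter
defined by another graph: explicit Aizenman–Grimmett gaps + explicit slab scaling give at best
exp/tower dependence on k, not k^A, and a direct argument at p_c needs flat 3D RSW; false iff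
crossover is anomalous (R(k) ≥ k^A for all A).) [DuminilcopinKozmaTassion2020, AizenmanGrimmett1991,
MartineauSevero2019, arXiv:1512.09107, arXiv:1603.06884, KestenScalingCMP1987, Grimmett1999]
#5 ConeRung (crux) — THE CONE RUNG (frame crux, top of the filed ladder): for every m, bond
percolation on ℤ³ minus the double cone {ρ < |x_0|/m} about the x_0-axis, i.e. on the induced graph
of V_m = {|x_0| ≤ m·ρ}, has θ = 0 at every vertex at p_c(ℤ³). Antitone family exhausting ℤ³ minus a
punctured line; m = 0 is the plane, the thin cones of slope 1/M' < 1 (between m = 0 and m = 1)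
follow from FlatAnnulusCrossing via SmallConeRungOfFlatAnnulus, integer m ≥ 1 from its all-aspect
version (two-layer plan); implied by the conjunct and by X_B of route PercAnnulusCrossing, weaker
than both. [deps: FlatAnnulusCrossing] [difficulty: open-problem] (why it might fail: For large m
the deleted double cone is thin, so ConeRung is X_B-strength (crossing bounds for thick washers,
open since 1980s; SpanningClustersAboveSix shows the analogue fails for d>6); false in a jump world
exactly when LineConeRemoval holds.) [Aizenman1997, BorgsChayesKestenSpencer1999, arXiv:1512.09107,
Grimmett1999, Literature.Barriers.CriticalPhenomena.SpanningClustersAboveSix]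
#6 LineConeRemoval (crux) — LINE-CONE REMOVAL (the same-p bridge, conjunct-adjacent and declared
so): if θ_{ℤ³}(p_c) > 0 then for SOME m some vertex of V_m = ℤ³ minus the double cone {ρ < |x_0|/m}
percolates inside V_m at p_c — deleting a zero-density double cone of arbitrarily small aperture
about a line cannot destroy a critical infinite cluster. True for every p > p_c by
Grimmett–Marstrand Thm 7.2 with F a half-plane (for m ≥ 1, V_m contains half-slabs {|x_0| ≤ k, x_1 ≥
k} of every thickness); vacuous if θ(p_c) = 0; the weakest removal statement compatible with a filed
rung (the still weaker AxisRemoval pairs only with 'ℤ³ minus a line', which has no engine but X_B).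
[deps: ConeRung] [difficulty: open-problem] (why it might fail: Same-p transfer of percolation to a
sub-domain: for p>p_c it is Grimmett–Marstrand, at p=p_c it meets SprinklingRenormalisation head-on
and, unlike BGN's half-space, the double-cone complement has no common steering direction;
unrefutable directly (vacuous iff θ(p_c)=0).) [Grimmett1999, GrimmettMarstrand1990,
BarskyGrimmettNewman1991, arXiv:math/0206130,
Literature.Barriers.CriticalPhenomena.SprinklingRenormalisation,
DuminilCopinSidoraviciusTassion2016]
#9 FreeRung (support) — THE FREE RUNG (new small theorem, provable now): there is a nondecreasing
UNBOUNDED f : ℕ → ℕ such that the divergent slab V_f = {|x_0| ≤ f(ρ)} has θ = 0 at every vertex at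
p_c(ℤ³). Proof (no strictness, no sharpness): θ_{V_f}(x) ≤ P(x ↔ {ρ = r} inside V_f ∩ {ρ ≤ r}) ≤
G_{f(r)}(r − ρ(x)) with G_k(n) = max over the 2k+1 layers of P_{p_c}(v ↔ sup-distance ≥ n inside
C_k); G_k(n) → 0 for each k ≥ 1 by continuity from above and θ_{C_k}(·, p_c(ℤ³)) = 0
(theta_slab_criticalProbI_eq_zero transported to the centred slab by theta_iso /
mul_theta_le_theta_of_adj); choose r_1 < r_2 < … with G_j(r_j/2) ≤ 2^{−j} and f = j on [r_j,
r_{j+1}), f = 1 below r_1. [difficulty: provable-now] [DuminilCopinSidoraviciusTassion2016,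
Literature.Probability.Percolation.theta_slab_criticalProbI_eq_zero,
Literature.Probability.Percolation.theta_induce_eq_real_percolatesVia, Grimmett1999]
#9 SublinearRungOfOneScale (support) — GLUE (provable now): OneScaleSlabs → Rung(f) for every
nondecreasing f with f(r)/r → 0. Proof: for x ∈ V_f, θ_{V_f}(x) ≤ P(x ↔ lateral distance ≥ r − ρ(x)
inside C_{max(1,f(r))}) ≤ ρ'(⌊(r − ρ(x))/max(1,f(r))⌋) → 0 (V_f ∩ {ρ ≤ r} ⊆ C_{f(r)} by
monotonicity; coupling of θ on the induced graph with openConnIn events via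
theta_induce_eq_real_percolatesVia). [difficulty: provable-now]
[Literature.Probability.Percolation.theta_induce_eq_real_percolatesVia, arXiv:1401.7130]
#9 SmallConeRungOfFlatAnnulus (support) — GLUE (provable now): FlatAnnulusCrossing (with constants
M, c) → for M' = 2M and every nondecreasing f with M'·f(r) ≤ r eventually, Rung(f). Proof: x ↔ ∞
inside V_f forces, for all large even j, a radial crossing inside {2^j ≤ ρ ≤ 2^{j+1}} ∩
C_{max(1,f(2^{j+1}))} (a flat washer with M·k ≤ 2^j); these events live on disjoint edge sets, are
independent, each has probability ≤ 1 − c, so the intersection is null (the dyadic-annulus argument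
of NTW §3.8 / route PercAnnulusCrossing's CritCrossingPolyDecay). [difficulty: provable-now]
[arXiv:1512.09107, Grimmett1999,
Literature.Probability.Percolation.theta_induce_eq_real_percolatesVia]
#9 PolyRungOfCrossover (support) — GLUE (provable now): SlabCrossoverPolynomial (constants A, C) →
Rung(f) for f(r) = ⌈r^a⌉ with a = 1/(A+1) (any 0 < a < 1/A works): θ_{V_f}(x) ≤ C f(r)^C exp(−(r −
ρ(x))/(C f(r)^A)) → 0 since f(r)^A ≤ 2^A r^{aA} with aA < 1, so the exponent grows like r^{1−aA}
against a polynomial prefactor; f is nondecreasing with r^a ≤ f(r). [difficulty: provable-now]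
[Literature.Probability.Percolation.theta_induce_eq_real_percolatesVia, Grimmett1999]
#9 SlabStrictSubcritical (support) — STRICT SUBCRITICALITY OF EVERY SLAB AT THE BULK CRITICAL POINT
(published theorem, not in tree; first waypoint of FlatAnnulusCrossing / SlabCrossoverPolynomial,
NOT needed by FreeRung or OneScaleSlabs): p_c(ℤ³) < p_c(ℤ³[C_k], x) for every k and every vertex x.
Source proof: MartineauSevero2019 Cor 2.2 with G = ℤ³, Γ = (2k+1)ℤ acting by translation of x_0
(free, quasi-transitive quotient ℤ² × ℤ/(2k+1), p_c(ℤ³) < 1) gives p_c(ℤ³) < p_c(ℤ² × ℤ/(2k+1)ℤ) ≤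
p_c(C_k) (C_k is a spanning subgraph of the periodic slab; k = 0: Γ = ℤ, quotient ℤ²); the older
pointer is Aizenman–Grimmett essential enhancements, Grimmett1999 §3.3 item C p.66 (slab case only
sketched). To be vendored as a Literature named fact (cite item filed) or proved. [difficulty: XL]
[MartineauSevero2019, AizenmanGrimmett1991, Grimmett1999, BenjaminiSchramm1996,
Literature.Probability.Percolation.criticalProb_le_induce]

TWO-LAYER PLAN. Foreseen glued splits (k ≤ 3, depth 1), none filed now: ConeRung ⇐
FlatAnnulusCrossingAll (∀ aspect m ∃ c_m: washers {|z_0| ≤ k, R ≤ ρ ≤ 2R}, k ≤ mR, crossed w.p. ≤ 1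
− c_m) → ConeRungGlue (dyadic independence, as SmallConeRungOfFlatAnnulus) → ConeRung;
FlatAnnulusCrossingAll ⇐ FlatAnnulusCrossing → AspectLifting (an RSW-type comparison raising the
aspect from 1/M to m — the genuinely 3D step) → FlatAnnulusCrossingAll; SlabCrossoverPolynomial ⇐
PolynomialGap (p_c(C_k) − p_c(ℤ³) ≥ k^{−B}: quantitative Martineau–Severo/Aizenman–Grimmett) →
SlabScalingExplicit (ξ(C_k; p_c(C_k) − t) ≤ C k^C t^{−C}: Kesten scaling in slabs with
NTW/Basu–Sapozhnikov constants tracked) → SlabCrossoverPolynomial; OneScaleSlabs ⇐ MiddleSlabOneBit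
(sup_k P(lateral crossing of aspect K₀ inside the middle half-slab) < 1) → FirstTouchRecursion (a
long in-slab path either stays in the middle half — recurse on thickness — or touches a face, after
which BGN's no-creeping bound, free in tree, applies) → OneScaleSlabs (engine E3 of card
no-creeping-tortuosity-price; E2 = extremal-point mass transport from BGN finiteness is the
alternative).

KILL CRITERIA. (i) A refutation of OneScaleSlabs or FlatAnnulusCrossing (anomalous crossover:
in-slab lateral connections ≫ thickness at bulk p_c along k_j → ∞) kills every rung above FreeRung
and closes the route as a ladder (close refuted:OneScaleSlabs) — and would be a remarkable theorem
about 3D criticality in its own right; (ii) SlabCrossoverPolynomial refuted alone (R(k)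
super-polynomial but U true) only removes rung family r^a: drop the item; (iii) ConeRung refuted for
some m ⇒ θ(p_c) > 0, i.e. the conjunct is refuted (¬ConeRung m ⇒ θ_{V_m} > 0 ⇒ θ_{ℤ³} > 0): the
summit breaks, not just the route; (iv) LineConeRemoval cannot be refuted without refuting θ(p_c) =
0 ∧ ¬…; a refuter showing that EVERY same-p removal proof must pass through a finite-size criterion
at η = 0 (SprinklingRenormalisation in full strength) forces the pivot 'replace the top pair by X_B
of PercAnnulusCrossing' (close superseded if nothing else remains); (v) X_B proved elsewhere moots
ConeRung/LineConeRemoval (conjunct done) but NOT the engines r2–r4, which stay as theorems about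
crossover; (vi) FreeRung failing to be provable as sketched (it should be a two-week item) signals a
mis-typed statement — restate, do not close.

NOT DECOMPOSED YET. The all-aspect washer RSW and the aspect-lifting comparison (children of
ConeRung); quantitative strictness PolynomialGap and explicit slab scaling (children of
SlabCrossoverPolynomial) — including the weaker but reachable variants 'gap(k) ≥ e^{−Ck}' (explicit
Aizenman–Grimmett through a gadget of size O(k)) ⇒ tower crossover ⇒ Rung(log log r), to be filed as
support once someone holds the constants; the alternative top pair TopRung ('ℤ³ minus the punctured
x_0-axis does not percolate at p_c') + AxisRemoval (weakest conceivable removal: a line), recorded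
but not filed because TopRung has no engine short of X_B; p_c(V_f) = p_c(ℤ³) for unbounded f
(Grimmett–Marstrand Thm 7.2 with F a half-plane; context making each rung a statement about a graph
AT ITS OWN critical point; needs GM for general F, not in tree — NUMBERS); site version; other
axes/lines (lattice symmetry); the E1/E2/E3 engines of OneScaleSlabs.

CHEAPEST FALSIFIER. Numerics first (kit, hours, not run this session — hub is compute-free and the
card carries no job): at p = 0.2488126 measure the lateral one-arm probability P(x ↔ lateral
distance Kk inside C_k) for k = 2,4,8,16 and K = 2..8 from interior x, and the radial crossing
frequency of flat washers R = Mk, M = 4, 8; a ratio ξ(C_k; p_c)/k growing with k, or washer-crossing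
frequencies drifting to 1 with k at fixed M, kills OneScaleSlabs / FlatAnnulusCrossing and caps the
ladder at FreeRung. Literature second: Chayes–Chayes 1986b (doi:10.1088/0305-4470/19/15/026,
acq-01778 open, unread here) — if it already proves absence of percolation at the bulk critical
point in divergent wedges of ℤ³ beyond the plane, FreeRung is 'known' (the engines are untouched).
Lookup third: MartineauSevero2019 Cor 2.2 read this session (arXiv:1803.09686 pp.3–4): hypotheses
met for ℤ³ → ℤ² × ℤ/n, so SlabStrictSubcritical is a citation, not a risk.

NUMBERS. p_c(ℤ³, bond) = 0.2488126(5) (numerical; Wang–Zhou–Zhang–Garoni–Deng arXiv:1302.0421);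
p_c(ℤ²) = 1/2 (Kesten1980; C_0 = plane endpoint); ν₃ ≈ 0.88 so the physical gap p_c(C_k) − p_c(ℤ³) ≍
k^{−1/ν₃} ≈ k^{−1.14} and R(k) := ξ(C_k; p_c(ℤ³)) ≍ k (crossover exponent 1/ν₃; the only rigorous
bound is from the other side, DuminilcopinKozmaTassion2020: ξ(p) ≤ exp(C/(p_c − p)²) below p_c in d
= 3); NTW arXiv:1512.09107 Remark p.7: slab RSW constants c(k) → 0, 'ℤ³ corresponds to k = ∞';
one-arm exponent at p_c(ℤ³) ≈ 0.48·(1/ν)… (β/ν ≈ 0.477, arXiv:1302.0421) — numerical only. Rung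
table: FreeRung (f inexplicit, provable now) < Rung(log log r) (explicit AG + slab scaling, not
filed) < Rung(r^a) ⇐ SlabCrossoverPolynomial < Rung(o(r)) ⇐ OneScaleSlabs < Rung(r/2M) ⇐
FlatAnnulusCrossing < ConeRung (all m) < TopRung < conjunct. Items at open: 11 (5 cruxes, 5 support,
1 assembly).

DEFINITION REQUESTS. None needed for the items (V_f, C_k, ρ and the washer are inline set-builders
over Site 3 = Fin 3 → ℤ; θ on induced graphs and openConnIn events are the HalfSpace.lean /
PercAnnulusCrossing conventions). Cite fact wanted (filed after open): MartineauSevero2019 Cor 2.2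
specialised to ℤ³ → ℤ² × ℤ/nℤ (n ≥ 1): p_c(ℤ³) < p_c(ℤ² □ C_n), from which SlabStrictSubcritical
follows by spanning-subgraph monotonicity; optional later: a Literature notion `divergentSlab f` if
several routes start quoting V_f.

Novelty: Searches (2026-08-15; local searchd resetting and arXiv/OpenAlex/S2 rate-limited this hour, so
zbMATH + citation graph + galaxy): `lit search --source zbmath` "percolation wedges" (10:
ChayesChayes1986b zbl 0636.60105; Angel–Benjamini–Berger–Peres arXiv:math/0206130; Häggström–Mossel
1998), "percolation slabs critical" (12: DST arXiv:1401.7130, NTW arXiv:1512.09107, Basu–Sapozhnikov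
arXiv:1512.05178, Damron–Newman–Sidoravicius arXiv:1211.4138, de Lima–Martineau–Sanchis–…
arXiv:2010.06736, GrimmettMarstrand1990), "Strict monotonicity of percolation thresholds under
covering maps" (MartineauSevero2019, read pp.1–7), four narrower zbMATH queries (0–1 hits, one
physics crossover paper doi:10.1016/j.physleta.2010.11.043); `lit citing arxiv:1401.7130` (32 citing
works screened: none on slabs of growing thickness or on slabs at the BULK critical point; nearest
2408.10927 columnar disorder, 2401.16357 robust clusters in a slab, DKT arXiv:1902.03207); `lit
frontier CriticalPhenomena --since 2021` (30, none relevant); `lit galaxy search --star all`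
"percolation on wedges" / "intermediate phases on wedges" / "crossover from three to two dimensions"
(→ Yu Zhang 1992 doi:10.1088/0305-4470/25/24/015 'Failure of the power laws on some subgraphs of the
Z^2 lattice', read pp.1–6: 2D wedges G(x^a), p_c = 1/2, θ(1/2) = 0, no power law; Hammersley
festschrift 1990); Grimmett1999 held text pp.66, 146–148 (§3.3.C strictness sketch, §7.1); the sub's
9 route files, 130 idea cards, negatives index (1  [refs: 10.1016/j.physleta.2010.11.043, 10.1088/0305-4470/25/24/015, math/0206130, 1401.7130, 1512.09107, 1512.05178, 1211.4138, 2010.06736, 1902.03207, doi:10.1016/j.physleta.2010.11.043, arxiv:1401.7130, doi:10.1088/0305-4470/25/24/015, GrimmettMarstrand1990, MartineauSevero2019, Grimmett1999, DuminilCopinSidoraviciusTassion2016, NewmanTassionWu2017]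

Barriers (technique_class: divergent-slab, crossover-length, quasi-planar-rsw): - technique_class: divergent-slab, crossover-length, quasi-planar-rsw
- Literature.Barriers.CriticalPhenomena.SlabLimitUniformControl: evaded in form (no k → ∞ passage:
every rung is one graph at p_c(ℤ³)) and engaged in substance (OneScaleSlabs / FlatAnnulusCrossing /
SlabCrossoverPolynomial ARE uniform-in-thickness moduli, consumed at finite thickness); the
barrier's limit reappears only above ConeRung, where the route files LineConeRemoval instead of a
limit.
- Literature.Barriers.CriticalPhenomena.SprinklingRenormalisation: not engaged by any rung or engine
(subcritical-side statements, union bounds, dyadic independence; Grimmett–Marstrand enters only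
through the PROVED slab_blocks / SprinklingRenormalisation_holds and only for context p_c(V_f) =
p_c); engaged HEAD-ON by LineConeRemoval (same-p transfer to a sub-domain), declared
conjunct-adjacent — it does not evade; the bet is that a zero-density double cone is the cheapest
deletion for which a same-p argument might exist, and that the ladder below it is worth having
regardless.
- Literature.Barriers.CriticalPhenomena.TransverseCrossingsNeedNotMeet: bites on FlatAnnulusCrossing
and on any RSW/gluing proof of ConeRung (washers are 3D boxes); OneScaleSlabs' engines E2/E3 (mass
transport from BGN finiteness; first-touch recursion) and the glue items use no
crossing-intersection input; DST's multi-valued-map gluing (Lemma 6, in tree) is the available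
substitute inside slabs of FIXED thickness only.
- Literature.Barriers.Crit

Novelty grade: new-combination — ROUTE REVIEW refuter-rreview dc4d2026 gen3 (2026-08-15; delta pass over gen0+gen2+batch refuters, nothing redone). (1) Module builds after the 14:32Z re-write: Probe1.lean rc0, 11/11 decls; Assembly re-proved on the materialised decls (same as A1.lean on 6708/6702). (2) Negatives: 1 in this sub (Per (refuter refuter-rreview-route-CriticalPhenomena--dc4d2026-g3-0, 2026-08-15T14:59:13Z; prior: Grimmett1999 Thm 11.55, ChayesChayes1986b (doi:10.1088/0305-4470/19/15/026), Zhang1992 (doi:10.1088/0305-4470/25/24/015), DuminilCopinSidoraviciusTassion2016 (arXiv:1401.7130), NewmanTassionWu2017 (arXiv:1512.09107), BarskyGrimmettNewman1991, MartineauSevero2019, SottaLong2003 (doi:10.1140/epje/i2002-10161-6))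

History (route lifecycle, newest last):
- 2026-08-29T07:03:22Z · DORMANT — reconciler: no traction for 5 d (last activity statement-closed at 2026-08-24T04:47:13Z); parked, not closed — `ledger route dormant route-CriticalPhenomena-Per (operator:999:2417303)

sub-problem: PercolationContinuityZ3 · status: dormant · opened planner-plancard-CriticalPhenomena-Percolatio-34897ab6-0 2026-08-15T11:50:39Z · rev 3 · ledger route-CriticalPhenomena-PercDivergentSlabLadder
GENERATED by the gate from the ledger (D-0016/17). Provers cite these decls: `theorem foo : Summit.CriticalPhenomena.PercolationContinuityZ3.Theses.PercDivergentSlabLadder.<Decl> := …` in Summits/CriticalPhenomena/PercolationContinuityZ3/Theorems/<Name>.lean.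
-/

namespace Summit.CriticalPhenomena.PercolationContinuityZ3.Theses.PercDivergentSlabLadder

open scoped BigOperators Topology Manifold Classical MeasureTheory ProbabilityTheory Matrix InnerProductSpace ComplexConjugate ContinuousMap
open Filter Set Function TopologicalSpace MeasureTheory

attribute [summit_statement] _root_.PercolationContinuityZ3

/-- item stmt-CriticalPhenomena-6701 · crux · rank 5 · closed · proved by Summit.CriticalPhenomena.PercolationContinuityZ3.Theorems.PercDivergentSlabLadderConeRung.coneRung_proof @ 7974026f4dee (prover) · by planner
why it might fail: Implied by the conjunct; for m>=1 V_m contains half-slabs of every width, so neither fixed-width gluing (DST) nor half-space steering (BGN) reaches it: X_B strength (thick-box crossing bounds at p_c open, ICM2018 Rmk 5.2; fails for d>6, SpanningClustersAboveSix). False iff jump + LineConeRemoval.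
sources: DuminilCopinICM2018, Aizenman1997, BorgsChayesKestenSpencer1999, BarskyGrimmettNewman1991, arXiv:1401.7130, Grimmett1999
[crux] THE CONE RUNG (frame crux, top of the filed ladder): for every m, bond percolation on ℤ³
minus the double cone {ρ < |x_0|/m} about the x_0-axis, i.e. on the induced graph of V_m = {|x_0| ≤
m·ρ}, has θ = 0 at every vertex at p_c(ℤ³). Antitone family exhausting ℤ³ minus a punctured line; m
= 0 is the plane, the thin cones of slope 1/M' < 1 (between m = 0 and m = 1) follow from
FlatAnnulusCrossing via SmallConeRungOfFlatAnnulus, integer m ≥ 1 from its all-aspect version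
(two-layer plan); implied by the conjunct and by X_B of route PercAnnulusCrossing, weaker than both.
[deps: FlatAnnulusCrossing] [difficulty: open-problem] -/
@[route_item "route-CriticalPhenomena-PercDivergentSlabLadder"]
def ConeRung : Prop :=
  ∀ (m : ℕ) (x : ↥{z : Literature.Probability.LatticeModels.Site 3 | |z 0| ≤ (m : ℤ) * max |z 1| |z 2|}), Literature.Probability.Percolation.theta ((Literature.Probability.LatticeModels.zdGraph 3).induce {z : Literature.Probability.LatticeModels.Site 3 | |z 0| ≤ (m : ℤ) * max |z 1| |z 2|}) x (Literature.Probability.Percolation.criticalProbI 3) = 0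

-- `ConeRung` holds: proved by `Summit.CriticalPhenomena.PercolationContinuityZ3.Theorems.PercDivergentSlabLadderConeRung.coneRung_proof` @ 7974026f4dee (its module imports this route file, so no `_holds` link can be stated here).

/-- item stmt-CriticalPhenomena-6702 · crux · rank 6 · closed · proved by Summit.CriticalPhenomena.PercolationContinuityZ3.Theorems.PercDivergentSlabLadderLineConeRemoval.lineConeRemoval_proof @ 43eee089a40d (prover) · by planner
why it might fail: Lean-verified LCR <-> (ConeRung -> conjunct) (A1.lean): the converse glue holding ALL same-p content, no mechanism. p>p_c: Grimmett-Marstrand (in tree); p=p_c: meets SprinklingRenormalisation head-on (Grimmett1999 p.162); BGN steering needs a half-space. False iff theta(p_c)>0 yet no V_m percolates.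
sources: Grimmett1999, GrimmettMarstrand1990, BarskyGrimmettNewman1991, DuminilcopinKozmaTassion2020, arXiv:math/0206130, Literature.Barriers.CriticalPhenomena.SprinklingRenormalisation
[crux] LINE-CONE REMOVAL (the same-p bridge, conjunct-adjacent and declared so): if θ_{ℤ³}(p_c) > 0
then for SOME m some vertex of V_m = ℤ³ minus the double cone {ρ < |x_0|/m} percolates inside V_m at
p_c — deleting a zero-density double cone of arbitrarily small aperture about a line cannot destroy
a critical infinite cluster. True for every p > p_c by Grimmett–Marstrand Thm 7.2 with F a
half-plane (for m ≥ 1, V_m contains half-slabs {|x_0| ≤ k, x_1 ≥ k} of every thickness); vacuous if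
θ(p_c) = 0; the weakest removal statement compatible with a filed rung (the still weaker AxisRemoval
pairs only with 'ℤ³ minus a line', which has no engine but X_B). [deps: ConeRung] [difficulty:
open-problem] -/
@[route_item "route-CriticalPhenomena-PercDivergentSlabLadder"]
def LineConeRemoval : Prop :=
  0 < Literature.Probability.Percolation.theta (Literature.Probability.LatticeModels.zdGraph 3) 0 (Literature.Probability.Percolation.criticalProbI 3) → ∃ (m : ℕ) (x : ↥{z : Literature.Probability.LatticeModels.Site 3 | |z 0| ≤ (m : ℤ) * max |z 1| |z 2|}), 0 < Literature.Probability.Percolation.theta ((Literature.Probability.LatticeModels.zdGraph 3).induce {z : Literature.Probability.LatticeModels.Site 3 | |z 0| ≤ (m : ℤ) * max |z 1| |z 2|}) x (Literature.Probability.Percolation.criticalProbI 3)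

-- `LineConeRemoval` holds: proved by `Summit.CriticalPhenomena.PercolationContinuityZ3.Theorems.PercDivergentSlabLadderLineConeRemoval.lineConeRemoval_proof` @ 43eee089a40d (its module imports this route file, so no `_holds` link can be stated here).

/-- item stmt-CriticalPhenomena-6698 · aside · rank 2 · closed · proved by Summit.CriticalPhenomena.PercolationContinuityZ3.Theorems.OneScaleSlabs.oneScaleSlabs_proof @ ddc3f5d30719 (prover) · by planner
why it might fail: Content = uniformity in k at p_c(Z^3): print has only fixed-k (DST; NTW Thm 3.1 is at p_c(S_k), c(k)->0) and face-point (BGN) shadows; union bound 16Kk^2*k^-0.48 not uniform, a one-arm-at-scale-k argument is the open step. Implied by theta(p_c)=0: false only in a jump world with in-slab reach >> k.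
sources: arXiv:1512.09107, arXiv:1401.7130, BarskyGrimmettNewman1991, arXiv:1512.05178, arXiv:2512.05947, Cardy1996
[crux] ONE-SCALE SLABS (= crux U of card no-creeping-tortuosity-price; this decl is meant to be
shared): there is ρ'(K) → 0 such that for every half-width k ≥ 1, every K and every vertex x, the
probability at p_c(ℤ³) that x is joined INSIDE the slab C_k = {|z_0| ≤ k} to a vertex at lateral
(ρ-)distance ≥ K·k is at most ρ'(K) — slabs at the bulk critical point are subcritical at exactly
one scale, their thickness, uniformly in the thickness. For x on a face it is free from BGN (in
tree); for fixed k it is free from DST (in tree); the content is uniformity over interior x and k.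
Glue SublinearRungOfOneScale turns it into Rung(f) for every f = o(r). [difficulty: L] -/
@[route_item "route-CriticalPhenomena-PercDivergentSlabLadder"]
def OneScaleSlabs : Prop :=
  ∃ ρ : ℕ → ℝ, Filter.Tendsto ρ Filter.atTop (nhds 0) ∧ ∀ k K : ℕ, 1 ≤ k → ∀ x : Literature.Probability.LatticeModels.Site 3, (Literature.Probability.Percolation.bondPercolation (Literature.Probability.LatticeModels.zdGraph 3) (Literature.Probability.Percolation.criticalProbI 3)).real {ω | ∃ y : Literature.Probability.LatticeModels.Site 3, (K : ℤ) * k ≤ max |y 1 - x 1| |y 2 - x 2| ∧ ω ∈ Literature.Probability.Percolation.openConnIn {z : Literature.Probability.LatticeModels.Site 3 | |z 0| ≤ (k : ℤ)} x y} ≤ ρ K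

-- `OneScaleSlabs` holds: proved by `Summit.CriticalPhenomena.PercolationContinuityZ3.Theorems.OneScaleSlabs.oneScaleSlabs_proof` @ ddc3f5d30719 (its module imports this route file, so no `_holds` link can be stated here).

/-- item stmt-CriticalPhenomena-6699 · aside · rank 3 · open · by planner
why it might fail: RSW upper bound uniform in thickness, no planar input (transverse crossings of a thick washer need not meet); print's slab RSW is at p_c(S_k), c(k)->0 (NTW Thm 3.1); fixed k already needs MS Cor 2.2 + sharpness. NOT implied by theta(p_c)=0: false iff washers of one flat aspect get crossed w.p.->1.
sources: arXiv:1512.09107, arXiv:1512.05178, arXiv:1603.06884, MartineauSevero2019, DuminilCopinICM2018, Literature.Barriers.CriticalPhenomena.TransverseCrossingsNeedNotMeet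
[crux] RSW FOR FLAT WASHERS AT ONE ASPECT RATIO, uniformly in thickness: there are M and c > 0 such
that for all k ≥ 1 and R ≥ M·k, at p_c(ℤ³) the flat washer {|z_0| ≤ k, R ≤ ρ ≤ 2R} is crossed
radially inside itself (open path from ρ = R to ρ = 2R) with probability ≤ 1 − c. The scaling
picture says far more (probability ≲ M e^{−cM} as k → ∞); only 'bounded away from 1 for ONE flat
aspect' is asked. Glue SmallConeRungOfFlatAnnulus turns it into Rung(f) for every f with f(r) ≤
r/(2M) eventually — the first CONE rungs. Fixed-k shadow: sup_R < 1 needs strict subcriticality of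
C_k at p_c(ℤ³) (SlabStrictSubcritical) plus sharpness, or NTW's slab RSW. [difficulty: L] -/
@[route_item "route-CriticalPhenomena-PercDivergentSlabLadder"]
def FlatAnnulusCrossing : Prop :=
  ∃ (M : ℕ) (c : ℝ), 0 < c ∧ ∀ k R : ℕ, 1 ≤ k → M * k ≤ R → (Literature.Probability.Percolation.bondPercolation (Literature.Probability.LatticeModels.zdGraph 3) (Literature.Probability.Percolation.criticalProbI 3)).real {ω | ∃ x y : Literature.Probability.LatticeModels.Site 3, max |x 1| |x 2| = (R : ℤ) ∧ max |y 1| |y 2| = 2 * (R : ℤ) ∧ ω ∈ Literature.Probability.Percolation.openConnIn {z : Literature.Probability.LatticeModels.Site 3 | |z 0| ≤ (k : ℤ) ∧ (R : ℤ) ≤ max |z 1| |z 2| ∧ max |z 1| |z 2| ≤ 2 * (R : ℤ)} x y} ≤ 1 - c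

/-- item stmt-CriticalPhenomena-6700 · aside · rank 4 · open · by planner
why it might fail: Asks xi(C_k;p_c(Z^3)) <= Ck^A: strictness p_c(Z^3)<p_c(C_k) is only qualitative (Aizenman-Grimmett; MS Cor 2.2) and xi(p)<=exp(C/|p-p_c|^2) (DKT2020) composes to exp/tower in k, not k^A; a direct proof needs flat 3D RSW. Not implied by theta(p_c)=0; false iff crossover is super-polynomial.
sources: DuminilcopinKozmaTassion2020, AizenmanGrimmett1991, MartineauSevero2019, arXiv:1512.09107, arXiv:1603.06884, KestenScalingCMP1987
[crux] POLYNOMIAL CROSSOVER (card Crux 1): there are A, C > 0 such that for every k ≥ 1, n and x,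
P_{p_c(ℤ³)}(x is joined inside C_k to lateral distance ≥ n) ≤ C k^C exp(−n/(C k^A)) — the slab of
half-width k is exponentially subcritical at the bulk critical point with correlation length R(k) ≤
C k^A (truth: R(k) ≍ k). Implies strict subcriticality p_c(ℤ³) < p_c(C_k) for every k with a rate,
and (glue PolyRungOfCrossover) Rung(f) for f(r) = ⌈r^a⌉, any a < 1/A. Compatible with a jump (which
forces only R(k) ≥ ck), hence a genuine intermediate theorem. [difficulty: XL] -/
@[route_item "route-CriticalPhenomena-PercDivergentSlabLadder"]
def SlabCrossoverPolynomial : Prop :=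
  ∃ A C : ℝ, 0 < A ∧ 0 < C ∧ ∀ k n : ℕ, 1 ≤ k → ∀ x : Literature.Probability.LatticeModels.Site 3, (Literature.Probability.Percolation.bondPercolation (Literature.Probability.LatticeModels.zdGraph 3) (Literature.Probability.Percolation.criticalProbI 3)).real {ω | ∃ y : Literature.Probability.LatticeModels.Site 3, (n : ℤ) ≤ max |y 1 - x 1| |y 2 - x 2| ∧ ω ∈ Literature.Probability.Percolation.openConnIn {z : Literature.Probability.LatticeModels.Site 3 | |z 0| ≤ (k : ℤ)} x y} ≤ C * (k : ℝ) ^ C * Real.exp (-((n : ℝ) / (C * (k : ℝ) ^ A)))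

/-- item stmt-CriticalPhenomena-6703 · support · rank 9 · closed · proved by Summit.CriticalPhenomena.PercolationContinuityZ3.Theorems.PercDivergentSlabLadderFreeRung.freeRung_proof @ af6fbc295624 (prover) · by planner
sources: DuminilCopinSidoraviciusTassion2016, Literature.Probability.Percolation.theta_slab_criticalProbI_eq_zero, Literature.Probability.Percolation.theta_induce_eq_real_percolatesVia, Grimmett1999
[support] THE FREE RUNG (new small theorem, provable now): there is a nondecreasing UNBOUNDED f : ℕ
→ ℕ such that the divergent slab V_f = {|x_0| ≤ f(ρ)} has θ = 0 at every vertex at p_c(ℤ³). Proof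
(no strictness, no sharpness): θ_{V_f}(x) ≤ P(x ↔ {ρ = r} inside V_f ∩ {ρ ≤ r}) ≤ G_{f(r)}(r − ρ(x))
with G_k(n) = max over the 2k+1 layers of P_{p_c}(v ↔ sup-distance ≥ n inside C_k); G_k(n) → 0 for
each k ≥ 1 by continuity from above and θ_{C_k}(·, p_c(ℤ³)) = 0 (theta_slab_criticalProbI_eq_zero
transported to the centred slab by theta_iso / mul_theta_le_theta_of_adj); choose r_1 < r_2 < … with
G_j(r_j/2) ≤ 2^{−j} and f = j on [r_j, r_{j+1}), f = 1 below r_1. [difficulty: provable-now] -/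
@[route_item "route-CriticalPhenomena-PercDivergentSlabLadder"]
def FreeRung : Prop :=
  ∃ f : ℕ → ℕ, Monotone f ∧ (∀ K : ℕ, ∃ r : ℕ, K ≤ f r) ∧ ∀ x : ↥{z : Literature.Probability.LatticeModels.Site 3 | |z 0| ≤ ((f (max |z 1| |z 2|).toNat : ℕ) : ℤ)}, Literature.Probability.Percolation.theta ((Literature.Probability.LatticeModels.zdGraph 3).induce {z : Literature.Probability.LatticeModels.Site 3 | |z 0| ≤ ((f (max |z 1| |z 2|).toNat : ℕ) : ℤ)}) x (Literature.Probability.Percolation.criticalProbI 3) = 0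

-- `FreeRung` holds: proved by `Summit.CriticalPhenomena.PercolationContinuityZ3.Theorems.PercDivergentSlabLadderFreeRung.freeRung_proof` @ af6fbc295624 (its module imports this route file, so no `_holds` link can be stated here).

/-- item stmt-CriticalPhenomena-6704 · support · rank 9 · closed · proved by Summit.CriticalPhenomena.PercolationContinuityZ3.Theorems.PercDivergentSlabLadderSublinearRungOfOneScale.sublinearRungOfOneScale_proof @ af6fbc295624 (prover) · by planner
sources: Literature.Probability.Percolation.theta_induce_eq_real_percolatesVia, arXiv:1401.7130
[support] GLUE (provable now): OneScaleSlabs → Rung(f) for every nondecreasing f with f(r)/r → 0.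
Proof: for x ∈ V_f, θ_{V_f}(x) ≤ P(x ↔ lateral distance ≥ r − ρ(x) inside C_{max(1,f(r))}) ≤ ρ'(⌊(r
− ρ(x))/max(1,f(r))⌋) → 0 (V_f ∩ {ρ ≤ r} ⊆ C_{f(r)} by monotonicity; coupling of θ on the induced
graph with openConnIn events via theta_induce_eq_real_percolatesVia). [difficulty: provable-now] -/
@[route_item "route-CriticalPhenomena-PercDivergentSlabLadder"]
def SublinearRungOfOneScale : Prop :=
  (∃ ρ : ℕ → ℝ, Filter.Tendsto ρ Filter.atTop (nhds 0) ∧ ∀ k K : ℕ, 1 ≤ k → ∀ x : Literature.Probability.LatticeModels.Site 3, (Literature.Probability.Percolation.bondPercolation (Literature.Probability.LatticeModels.zdGraph 3) (Literature.Probability.Percolation.criticalProbI 3)).real {ω | ∃ y : Literature.Probability.LatticeModels.Site 3, (K : ℤ) * k ≤ max |y 1 - x 1| |y 2 - x 2| ∧ ω ∈ Literature.Probability.Percolation.openConnIn {z : Literature.Probability.LatticeModels.Site 3 | |z 0| ≤ (k : ℤ)} x y} ≤ ρ K) → ∀ f : ℕ → ℕ, Monotone f → Filter.Tendsto (fun r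 : ℕ => (f r : ℝ) / (r : ℝ)) Filter.atTop (nhds 0) → ∀ x : ↥{z : Literature.Probability.LatticeModels.Site 3 | |z 0| ≤ ((f (max |z 1| |z 2|).toNat : ℕ) : ℤ)}, Literature.Probability.Percolation.theta ((Literature.Probability.LatticeModels.zdGraph 3).induce {z : Literature.Probability.LatticeModels.Site 3 | |z 0| ≤ ((f (max |z 1| |z 2|).toNat : ℕ) : ℤ)}) x (Literature.Probability.Percolation.criticalProbI 3) = 0

-- `SublinearRungOfOneScale` holds: proved by `Summit.CriticalPhenomena.PercolationContinuityZ3.Theorems.PercDivergentSlabLadderSublinearRungOfOneScale.sublinearRungOfOneScale_proof` @ af6fbc295624 (its module imports this route file, so no `_holds` link can be stated here).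

/-- item stmt-CriticalPhenomena-6705 · support · rank 9 · closed · proved by Summit.CriticalPhenomena.PercolationContinuityZ3.Theorems.PercDivergentSlabLadderSmallConeRungOfFlatAnnulus.smallConeRungOfFlatAnnulus_proof @ b06e5bdcca33 (prover) · by planner
sources: arXiv:1512.09107, Grimmett1999, Literature.Probability.Percolation.theta_induce_eq_real_percolatesVia
[support] GLUE (provable now): FlatAnnulusCrossing (with constants M, c) → for M' = 2M and every
nondecreasing f with M'·f(r) ≤ r eventually, Rung(f). Proof: x ↔ ∞ inside V_f forces, for all large
even j, a radial crossing inside {2^j ≤ ρ ≤ 2^{j+1}} ∩ C_{max(1,f(2^{j+1}))} (a flat washer with M·k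
≤ 2^j); these events live on disjoint edge sets, are independent, each has probability ≤ 1 − c, so
the intersection is null (the dyadic-annulus argument of NTW §3.8 / route PercAnnulusCrossing's
CritCrossingPolyDecay). [difficulty: provable-now] -/
@[route_item "route-CriticalPhenomena-PercDivergentSlabLadder"]
def SmallConeRungOfFlatAnnulus : Prop :=
  (∃ (M : ℕ) (c : ℝ), 0 < c ∧ ∀ k R : ℕ, 1 ≤ k → M * k ≤ R → (Literature.Probability.Percolation.bondPercolation (Literature.Probability.LatticeModels.zdGraph 3) (Literature.Probability.Percolation.criticalProbI 3)).real {ω | ∃ x y : Literature.Probability.LatticeModels.Site 3, max |x 1| |x 2| = (R : ℤ) ∧ max |y 1| |y 2| = 2 * (R : ℤ) ∧ ω ∈ Literature.Probability.Percolation.openConnIn {z : Literature.Probability.LatticeModels.Site 3 | |z 0| ≤ (k : ℤ) ∧ (R : ℤ) ≤ max |z 1| |z 2| ∧ max |z 1| |z 2| ≤ 2 * (R : ℤ)} x y} ≤ 1 - c) → ∃ M' : ℕ, ∀ f : ℕ → ℕ, Monotone f → (∃ r₀ : ℕ, ∀ r : ℕ, r₀ ≤ r → M' * f r ≤ r) →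 ∀ x : ↥{z : Literature.Probability.LatticeModels.Site 3 | |z 0| ≤ ((f (max |z 1| |z 2|).toNat : ℕ) : ℤ)}, Literature.Probability.Percolation.theta ((Literature.Probability.LatticeModels.zdGraph 3).induce {z : Literature.Probability.LatticeModels.Site 3 | |z 0| ≤ ((f (max |z 1| |z 2|).toNat : ℕ) : ℤ)}) x (Literature.Probability.Percolation.criticalProbI 3) = 0

-- `SmallConeRungOfFlatAnnulus` holds: proved by `Summit.CriticalPhenomena.PercolationContinuityZ3.Theorems.PercDivergentSlabLadderSmallConeRungOfFlatAnnulus.smallConeRungOfFlatAnnulus_proof` @ b06e5bdcca33 (its module imports this route file, so no `_holds` link can be stated here).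

/-- item stmt-CriticalPhenomena-6706 · support · rank 9 · closed · proved by Summit.CriticalPhenomena.PercolationContinuityZ3.Theorems.PercDivergentSlabLadderPolyRungOfCrossover.polyRungOfCrossover_proof @ 4e72ed05b746 (prover) · by planner
sources: Literature.Probability.Percolation.theta_induce_eq_real_percolatesVia, Grimmett1999
[support] GLUE (provable now): SlabCrossoverPolynomial (constants A, C) → Rung(f) for f(r) = ⌈r^a⌉
with a = 1/(A+1) (any 0 < a < 1/A works): θ_{V_f}(x) ≤ C f(r)^C exp(−(r − ρ(x))/(C f(r)^A)) → 0
since f(r)^A ≤ 2^A r^{aA} with aA < 1, so the exponent grows like r^{1−aA} against a polynomial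
prefactor; f is nondecreasing with r^a ≤ f(r). [difficulty: provable-now] -/
@[route_item "route-CriticalPhenomena-PercDivergentSlabLadder"]
def PolyRungOfCrossover : Prop :=
  (∃ A C : ℝ, 0 < A ∧ 0 < C ∧ ∀ k n : ℕ, 1 ≤ k → ∀ x : Literature.Probability.LatticeModels.Site 3, (Literature.Probability.Percolation.bondPercolation (Literature.Probability.LatticeModels.zdGraph 3) (Literature.Probability.Percolation.criticalProbI 3)).real {ω | ∃ y : Literature.Probability.LatticeModels.Site 3, (n : ℤ) ≤ max |y 1 - x 1| |y 2 - x 2| ∧ ω ∈ Literature.Probability.Percolation.openConnIn {z : Literature.Probability.LatticeModels.Site 3 | |z 0| ≤ (k : ℤ)} x y} ≤ C * (k : ℝ) ^ C * Real.exp (-((n : ℝ) / (C * (k : ℝ) ^ A)))) → ∃ f : ℕ → ℕ, Monotone f ∧ (∃ a : ℝ, 0 < a ∧ ∀ r : ℕ, 1 ≤ r → (r : ℝ) ^ a ≤ f r) ∧ ∀ x : ↥{z : Literature.Probability.LatticeModels.Site 3 | |z 0| ≤ ((f (max |z 1| |z 2|).toNat : ℕ) : ℤ)}, Literature.Probability.Percolation.theta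 ((Literature.Probability.LatticeModels.zdGraph 3).induce {z : Literature.Probability.LatticeModels.Site 3 | |z 0| ≤ ((f (max |z 1| |z 2|).toNat : ℕ) : ℤ)}) x (Literature.Probability.Percolation.criticalProbI 3) = 0

-- `PolyRungOfCrossover` holds: proved by `Summit.CriticalPhenomena.PercolationContinuityZ3.Theorems.PercDivergentSlabLadderPolyRungOfCrossover.polyRungOfCrossover_proof` @ 4e72ed05b746 (its module imports this route file, so no `_holds` link can be stated here).

/-- item stmt-CriticalPhenomena-6707 · support · rank 9 · closed · proved by Summit.CriticalPhenomena.PercolationContinuityZ3.Theorems.SlabStrictSubcritical.slabStrictSubcritical_proof @ 99938464c964 (prover) · by planner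
sources: MartineauSevero2019, AizenmanGrimmett1991, Grimmett1999, BenjaminiSchramm1996, Literature.Probability.Percolation.criticalProb_le_induce
[support] STRICT SUBCRITICALITY OF EVERY SLAB AT THE BULK CRITICAL POINT (published theorem, not in
tree; first waypoint of FlatAnnulusCrossing / SlabCrossoverPolynomial, NOT needed by FreeRung or
OneScaleSlabs): p_c(ℤ³) < p_c(ℤ³[C_k], x) for every k and every vertex x. Source proof:
MartineauSevero2019 Cor 2.2 with G = ℤ³, Γ = (2k+1)ℤ acting by translation of x_0 (free,
quasi-transitive quotient ℤ² × ℤ/(2k+1), p_c(ℤ³) < 1) gives p_c(ℤ³) < p_c(ℤ² × ℤ/(2k+1)ℤ) ≤ p_c(C_k)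
(C_k is a spanning subgraph of the periodic slab; k = 0: Γ = ℤ, quotient ℤ²); the older pointer is
Aizenman–Grimmett essential enhancements, Grimmett1999 §3.3 item C p.66 (slab case only sketched).
To be vendored as a Literature named fact (cite item filed) or proved. [difficulty: XL] -/
@[route_item "route-CriticalPhenomena-PercDivergentSlabLadder"]
def SlabStrictSubcritical : Prop :=
  ∀ (k : ℕ) (x : ↥{z : Literature.Probability.LatticeModels.Site 3 | |z 0| ≤ (k : ℤ)}), Literature.Probability.Percolation.criticalProb (Literature.Probability.LatticeModels.zdGraph 3) (0 : Literature.Probability.LatticeModels.Site 3) < Literature.Probability.Percolation.criticalProb ((Literature.Probability.LatticeModels.zdGraph 3).induce {z : Literature.Probability.LatticeModels.Site 3 | |z 0| ≤ (k : ℤ)}) x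

-- `SlabStrictSubcritical` holds: proved by `Summit.CriticalPhenomena.PercolationContinuityZ3.Theorems.SlabStrictSubcritical.slabStrictSubcritical_proof` @ 99938464c964 (its module imports this route file, so no `_holds` link can be stated here).

/-- item stmt-CriticalPhenomena-6708 · assembly · rank 1 · closed · proved by Summit.CriticalPhenomena.PercolationContinuityZ3.Theorems.PercDivergentSlabLadderAssembly.assembly_proof @ 7974026f4dee (prover) · by planner
sources: DuminilCopinSidoraviciusTassion2016, Grimmett1999
[assembly] ConeRung → LineConeRemoval → PercolationContinuityZ3. -/
@[route_item "route-CriticalPhenomena-PercDivergentSlabLadder"]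
def Assembly : Prop :=
  ConeRung → LineConeRemoval → PercolationContinuityZ3

-- `Assembly` holds: proved by `Summit.CriticalPhenomena.PercolationContinuityZ3.Theorems.PercDivergentSlabLadderAssembly.assembly_proof` @ 7974026f4dee (its module imports this route file, so no `_holds` link can be stated here).

/-! D-0027 §2.1 — DECIDING THEOREM (planner-authored via `route open/edit --closes-file`; by operator:999:2941348 2026-08-15T15:25:00Z):
its hypotheses are this route's items and its conclusion the sub-problem Statement (glue_lint), and it elaborates with this file. -/

@[closes "route-CriticalPhenomena-PercDivergentSlabLadder"] theorem closes : OneScaleSlabs → FlatAnnulusCrossing → SlabCrossoverPolynomial → ConeRung → LineConeRemoval → FreeRung → SublinearRungOfOneScale → SmallConeRungOfFlatAnnulus → PolyRungOfCrossover → SlabStrictSubcritical → Assembly → _root_.PercolationContinuityZ3 := fun h_OneScaleSlabs h_FlatAnnulusCrossing h_SlabCrossoverPolynomial h_ConeRung h_LineConeRemoval h_FreeRung h_SublinearRungOfOneScale h_SmallConeRungOfFlatAnnulus h_PolyRungOfCrossover h_SlabStrictSubcritical h_Assembly => h_Assembly h_ConeRung h_LineConeRemoval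

end Summit.CriticalPhenomena.PercolationContinuityZ3.Theses.PercDivergentSlabLadder
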